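import Literature.AlgebraicGeometry.Resolution.ProjectiveSpaceRegular
import Literature.AlgebraicGeometry.Resolution.AlterationsProofs
import Mathlib.AlgebraicGeometry.Morphisms.Separated
import Mathlib.AlgebraicGeometry.Morphisms.ClosedImmersion
import Mathlib.AlgebraicGeometry.IdealSheaf.Subscheme
import Mathlib.RingTheory.DiscreteValuationRing.Basic
import Mathlib.RingTheory.RegularLocalRing.Defs
import HarnessLib

/-!
# `EquisingularLift`, line `strata-split` — a section of a separated `U → Spec O` (`O` a DVR)

Crux `stmt-ResolutionOfSingularities-15660` = `Theses.EquisingularLift.EquisingularLift`; helper sub-goal of the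
registered stub `stub_resolveOnePoint_dimOne` (the curve case: blow up the ambient `U`, smooth and separated over
`Spec O`, along a section `s : Spec O → U` through the singular point). This file packages the elementary facts
about such a section `s` of a separated `r : U → Spec O` (`s ≫ r = 𝟙`) over a discrete valuation ring `O`:

* `s` is a closed immersion (a section of a separated morphism);
* its centre `V(ker s) ≅ Spec O` is a regular scheme (`O` is a DVR, hence a regular ring);
* the image of the closed point of `Spec O` is a closed point of `U`;
* the support of the ideal sheaf `ker s` is exactly the image `s(Spec O)`.
-/

set_option linter.dupNamespace false -- mandated namespace
set_option linter.overlappingInstances false -- registered signature carries [IsDomain O] [IsDiscreteValuationRing O]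

noncomputable section

open CategoryTheory AlgebraicGeometry TopologicalSpace Topology
open Literature.AlgebraicGeometry.Resolution

namespace Summit.ResolutionOfSingularities.ResolutionOfSingularities.Cruxes.EquisingularLift.StrataSplit

/-- **A section of a separated morphism to `Spec` of a DVR.** For a discrete valuation ring `O`, a separated
`r : U → Spec O` and a section `s : Spec O → U` of `r` (`s ≫ r = 𝟙`): `s` is a closed immersion, the closed
subscheme `V(ker s)` (`≅ Spec O`) is regular, `s` maps the closed point of `Spec O` to a closed point of `U`, and
the support of `ker s` is the range of `s`. [folklore] -/
theorem section_isClosedImmersion_and_isRegular_ker : ∀ (O : Type) [CommRing O] [IsDomain O] [IsDiscreteValuationRing O] (U : AlgebraicGeometry.Scheme.{0}) (r : U ⟶ AlgebraicGeometry.Spec (.of O)) [AlgebraicGeometry.IsSeparated r] (s : AlgebraicGeometry.Spec (.of O) ⟶ U), CategoryTheory.CategoryStruct.comp s r = CategoryTheory.CategoryStruct.id _ → AlgebraicGeometry.IsClosedImmersion s ∧ Literature.AlgebraicGeometry.Resolution.Scheme.IsRegular s.ker.subscheme ∧ IsClosed ({s (IsLocalRing.closedPoint O)} : Set U) ∧ (s.ker.support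 : Set U) = Set.range s := by
  intro O _ _ _ U r _ s hs
  -- (1) a section of a separated morphism is a closed immersion
  -- adapted from Literature.AlgebraicGeometry.Resolution.DeJong1996.IsUnionOfSections.isClosedImmersion_of_comp_eq_id
  haveI : IsClosedImmersion s :=
    haveI : IsClosedImmersion (s ≫ r) := by rw [hs]; infer_instance
    .of_comp s r
  refine ⟨inferInstance, ?_, ?_, ?_⟩
  · -- (2) `V(ker s) ≅ Spec O` is regular: a DVR is a regular ring
    -- adapted from Literature.AlgebraicGeometry.Resolution.isRegular_ker_subscheme (BlowupSmoothProjective.lean)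
    haveI : IsRegularRing (CommRingCat.of O) := inferInstanceAs (IsRegularRing O)
    exact Scheme.IsRegular.of_isOpenImmersion (inv s.toImage) (Scheme.isRegular_Spec (.of O))
  · -- (3) the closed point goes to a closed point: closed immersions are closed maps
    have h := s.isClosedEmbedding.isClosedMap _ (IsLocalRing.isClosed_singleton_closedPoint O)
    have e : ({s (IsLocalRing.closedPoint O)} : Set U) = s '' {IsLocalRing.closedPoint O} :=
      Set.image_singleton.symm
    rw [e]
    exact h
  · -- (4) the support of `ker s` is the closure of the range, and the range is closed
    rw [Scheme.Hom.support_ker, s.isClosedEmbedding.isClosed_range.closure_eq]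

end Summit.ResolutionOfSingularities.ResolutionOfSingularities.Cruxes.EquisingularLift.StrataSplit

end
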